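import Mathlib.LinearAlgebra.Matrix.Determinant.Basic
import Mathlib.Data.Fin.Tuple.Basic
import Mathlib.Algebra.BigOperators.Fin
import Mathlib.Tactic.FieldSimp
import Mathlib.Tactic.Ring
import HarnessLib

/-!
# Cauchy's double alternant: the recurrence for `det (1/(x_i - y_j))`

Topic `LinearAlgebra/Matrix`, namespace `Literature.LinearAlgebra.Matrix`. The classical evaluation
of Cauchy's determinant (A.-L. Cauchy, *Mémoire sur les fonctions alternées et sur les sommes
alternées*, Exercices d'analyse et de phys. math. 2 (1841) 151–159; C. Krattenthaler, *Advanced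
determinant calculus*, Sém. Lothar. Combin. 42 (1999) B42q, eq. (2.7):
`det (1/(x_i + y_j)) = ∏_{i<j} (x_i - x_j)(y_i - y_j) / ∏_{i,j} (x_i + y_j)`), in the RECURSIVE form
that one round of the textbook row-and-column reduction produces, over any field:

* `cauchyMatrix x y n = ((x_i - y_j)⁻¹)_{i,j<n}` for sequences `x y : ℕ → K`;
* `det_cauchyMatrix_succ` — if `x_i ≠ y_j` for `i, j ≤ n` then
  `det C_{n+1} = [∏_{i<n} (x_n - x_i)(y_i - y_n) / ((x_n - y_n) ∏_{i<n} (x_n - y_i)(x_i - y_n))] · det C_n`.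

Proof (elementary row and column operations): subtract the last row from the others and
take out the factors `x_n - x_i` (rows) and `(x_n - y_j)⁻¹` (columns); then subtract the last column
from the others and take out `y_j - y_n` (columns) and `(x_i - y_n)⁻¹` (rows); the last row has become
`(0, …, 0, 1)`, and the Laplace expansion along it leaves `det C_n`. The closed product formula
follows by induction — `det_cauchyMatrix`:
  `det C_n = (∏_{j<n} ∏_{i<j} (x_j - x_i)(y_i - y_j)) / ∏_{i<n} ∏_{j<n} (x_i - y_j)` for `x_i ≠ y_j` (`i, j < n`),
  added for the second user (the Cauchy-minor bounds of the rh-explicit handoff track, ATTEMPT-14 LEMMA C) —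
while the first user needs only the ratio (the critical diagonal correlations of the
planar Ising model, `Literature.Probability.LatticeModels.PlanarIsingWuDiag`, where the entries are
`1/(i - j + ½)` and the RATIO `det C_{n+1}/det C_n` is Wu's recurrence). (Krattenthaler numbers the
double alternant (2.7), in the form `1/(X_i + Y_j)`; replace `Y_j` by `-y_j`.)

Mathlib has Vandermonde (`Matrix.det_vandermonde`) but no Cauchy determinant; the tree has the
division-free bialternant form `det (∏_{k≠j}(1 - x_iy_k)) = a_ρ(x)a_ρ(y)`
(`Literature.RingTheory.SymmetricFunctions.SchurPolynomials.det_prod_one_sub_mul`), from which the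
present statement could also be derived; the direct reduction is shorter. Anchors:
`Matrix.det_eq_of_forall_row_eq_smul_add_const`, `Matrix.det_mul_row`, `Matrix.det_mul_column`,
`Matrix.det_succ_row`, `Fin.succAbove_last`, `Fin.prod_univ_castSucc`.

## References

* C. Krattenthaler, *Advanced determinant calculus*, Sém. Lothar. Combin. 42 (1999), Art. B42q,
  §2.1, eq. (2.7) and its proof.
* A.-L. Cauchy, Exercices d'analyse et de physique mathématique 2 (1841) 151–159.
-/

noncomputable section

open Matrix Finset

namespace Literature.LinearAlgebra.Matrix

variable {K : Type*} [Field K]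

/-- **Cauchy's matrix** `C_n = ((x_i - y_j)⁻¹)_{i,j<n}` built from two sequences (indexed by
naturals, truncated at `n`). [cite: Krattenthaler1999, §2.1, eq. (2.7)] -/
def cauchyMatrix (x y : ℕ → K) (n : ℕ) : Matrix (Fin n) (Fin n) K :=
  Matrix.of fun i j => (x i - y j)⁻¹

/-- Entries of Cauchy's matrix. [folklore] -/
@[simp] theorem cauchyMatrix_apply (x y : ℕ → K) (n : ℕ) (i j : Fin n) :
    cauchyMatrix x y n i j = (x i - y j)⁻¹ := rfl

/-- `det C_0 = 1`. [folklore] -/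
theorem det_cauchyMatrix_zero (x y : ℕ → K) : (cauchyMatrix x y 0).det = 1 :=
  Matrix.det_isEmpty

/-- The determinant of a matrix on `Fin (n+1)` whose last row is `(0, …, 0, 1)` is the determinant
of its upper-left `n × n` block (Laplace expansion along the last row). [folklore] -/
theorem det_of_last_row_eq_single {n : ℕ} (B : Matrix (Fin (n + 1)) (Fin (n + 1)) K)
    (hlast : ∀ j, B (Fin.last n) j = if j = Fin.last n then 1 else 0) :
    B.det = (B.submatrix Fin.castSucc Fin.castSucc).det := by
  rw [Matrix.det_succ_row B (Fin.last n), Fin.sum_univ_castSucc]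
  have hzero : ∀ j : Fin n, (-1 : K) ^ ((Fin.last n : ℕ) + (Fin.castSucc j : ℕ)) * B (Fin.last n) (Fin.castSucc j) *
      (B.submatrix (Fin.last n).succAbove (Fin.castSucc j).succAbove).det = 0 := by
    intro j
    rw [hlast, if_neg (Fin.castSucc_lt_last j).ne, mul_zero, zero_mul]
  rw [Finset.sum_eq_zero fun j _ => hzero j, zero_add, hlast, if_pos rfl, mul_one, Fin.succAbove_last,
    Fin.val_last, ← two_mul, pow_mul, neg_one_sq, one_pow, one_mul]

/-- **The recurrence for Cauchy's determinant** (one round of row/column reduction of Cauchy's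
double alternant, Krattenthaler 1999, eq. (2.7)): if `x_i ≠ y_j` for all `i, j ≤ n`, then
`det C_{n+1} = [∏_{i<n} (x_n - x_i)(y_i - y_n) / ((x_n - y_n) ∏_{i<n} (x_n - y_i)(x_i - y_n))] · det C_n`. [cite: Krattenthaler1999, §2.1, eq. (2.7) (Cauchy's double alternant)] -/
theorem det_cauchyMatrix_succ (x y : ℕ → K) (n : ℕ) (hxy : ∀ i j : ℕ, i ≤ n → j ≤ n → x i ≠ y j) :
    (cauchyMatrix x y (n + 1)).det =
      (∏ i ∈ range n, ((x n - x i) * (y i - y n))) /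
          ((x n - y n) * ∏ i ∈ range n, ((x n - y i) * (x i - y n))) *
        (cauchyMatrix x y n).det := by
  -- abbreviations and non-vanishing denominators
  set A := cauchyMatrix x y (n + 1) with hA
  have hval : ∀ i : Fin (n + 1), (i : ℕ) ≤ n := fun i => Nat.lt_succ_iff.mp i.isLt
  have hd : ∀ i j : Fin (n + 1), x i - y j ≠ 0 := fun i j => sub_ne_zero.2 (hxy i j (hval i) (hval j))
  have hlastv : ((Fin.last n : Fin (n + 1)) : ℕ) = n := Fin.val_last n
  -- Step 1: subtract the last row from the other rows
  let B₁ : Matrix (Fin (n + 1)) (Fin (n + 1)) K := Matrix.of fun i j =>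
    if i = Fin.last n then A i j else A i j - A (Fin.last n) j
  have h1 : A.det = B₁.det := by
    refine Matrix.det_eq_of_forall_row_eq_smul_add_const (fun i => if i = Fin.last n then 0 else 1)
      (Fin.last n) (if_pos rfl) fun i j => ?_
    by_cases hi : i = Fin.last n
    · simp only [B₁, Matrix.of_apply, hi, if_true, zero_mul, add_zero]
    · simp only [B₁, Matrix.of_apply, hi, if_false, if_true, one_mul, sub_add_cancel]
  -- Step 2: `B₁ = (row factors) ∘ (column factors) ∘ B₂`
  let rowF : Fin (n + 1) → K := fun i => if i = Fin.last n then 1 else x n - x i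
  let colF : Fin (n + 1) → K := fun j => (x n - y j)⁻¹
  let B₂ : Matrix (Fin (n + 1)) (Fin (n + 1)) K := Matrix.of fun i j =>
    if i = Fin.last n then 1 else (x i - y j)⁻¹
  have h2 : B₁ = Matrix.of fun i j => rowF i * (Matrix.of fun i j => colF j * B₂ i j) i j := by
    ext i j
    by_cases hi : i = Fin.last n
    · simp only [B₁, B₂, rowF, colF, Matrix.of_apply, hi, if_true, one_mul, mul_one, hA,
        cauchyMatrix_apply, hlastv]
    · simp only [B₁, B₂, rowF, colF, Matrix.of_apply, hi, if_false, hA, cauchyMatrix_apply, hlastv]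
      have h1' := hd i j
      have h2' := hd (Fin.last n) j
      rw [hlastv] at h2'
      field_simp
      ring
  have h2det : B₁.det = (∏ i, rowF i) * ((∏ j, colF j) * B₂.det) := by
    rw [h2, Matrix.det_mul_column, Matrix.det_mul_row]
  -- Step 3: subtract the last column from the other columns (row operation on the transpose)
  let B₃ : Matrix (Fin (n + 1)) (Fin (n + 1)) K := Matrix.of fun i j =>
    if j = Fin.last n then B₂ i j else B₂ i j - B₂ i (Fin.last n)
  have h3 : B₂.det = B₃.det := by
    rw [← Matrix.det_transpose B₂, ← Matrix.det_transpose B₃]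
    refine Matrix.det_eq_of_forall_row_eq_smul_add_const (fun j => if j = Fin.last n then 0 else 1)
      (Fin.last n) (if_pos rfl) fun j i => ?_
    by_cases hj : j = Fin.last n
    · simp only [B₃, Matrix.transpose_apply, Matrix.of_apply, hj, if_true, zero_mul, add_zero]
    · simp only [B₃, Matrix.transpose_apply, Matrix.of_apply, hj, if_false, if_true, one_mul, sub_add_cancel]
  -- Step 4: `B₃ = (row factors) ∘ (column factors) ∘ B₄`, with last row of `B₄` = `(0,…,0,1)`
  let rowG : Fin (n + 1) → K := fun i => if i = Fin.last n then 1 else (x i - y n)⁻¹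
  let colG : Fin (n + 1) → K := fun j => if j = Fin.last n then 1 else y j - y n
  let B₄ : Matrix (Fin (n + 1)) (Fin (n + 1)) K := Matrix.of fun i j =>
    if i = Fin.last n then (if j = Fin.last n then 1 else 0)
    else (if j = Fin.last n then 1 else (x i - y j)⁻¹)
  have h4 : B₃ = Matrix.of fun i j => rowG i * (Matrix.of fun i j => colG j * B₄ i j) i j := by
    ext i j
    by_cases hi : i = Fin.last n <;> by_cases hj : j = Fin.last n
    · simp only [B₃, B₂, B₄, rowG, colG, Matrix.of_apply, hi, hj, if_true, mul_one]
    · simp only [B₃, B₂, B₄, rowG, colG, Matrix.of_apply, hi, hj, if_true, if_false, sub_self, mul_zero]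
    · simp only [B₃, B₂, B₄, rowG, colG, Matrix.of_apply, hi, hj, if_true, if_false, mul_one, hlastv]
    · simp only [B₃, B₂, B₄, rowG, colG, Matrix.of_apply, hi, hj, if_false, hlastv]
      have h1' := hd i j
      have h2' := hd i (Fin.last n)
      rw [hlastv] at h2'
      field_simp
      ring
  have h4det : B₃.det = (∏ i, rowG i) * ((∏ j, colG j) * B₄.det) := by
    rw [h4, Matrix.det_mul_column, Matrix.det_mul_row]
  -- Step 5: Laplace along the last row of `B₄`
  have h5 : B₄.det = (cauchyMatrix x y n).det := by
    rw [det_of_last_row_eq_single B₄ fun j => by simp only [B₄, Matrix.of_apply, if_true]]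
    congr 1
    ext i j
    simp only [Matrix.submatrix_apply, B₄, Matrix.of_apply, (Fin.castSucc_lt_last i).ne,
      (Fin.castSucc_lt_last j).ne, if_false, cauchyMatrix_apply, Fin.val_castSucc]
  -- the four products
  have hrowF : ∏ i, rowF i = ∏ i ∈ range n, (x n - x i) := by
    rw [Fin.prod_univ_castSucc, ← Fin.prod_univ_eq_prod_range (fun i => x n - x i) n]
    simp only [rowF, if_true, (Fin.castSucc_lt_last _).ne, if_false, Fin.val_castSucc, mul_one]
  have hcolF : ∏ j, colF j = (x n - y n)⁻¹ * ∏ j ∈ range n, (x n - y j)⁻¹ := by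
    rw [Fin.prod_univ_castSucc, ← Fin.prod_univ_eq_prod_range (fun j => (x n - y j)⁻¹) n]
    simp only [colF, Fin.val_castSucc, hlastv, mul_comm]
  have hrowG : ∏ i, rowG i = ∏ i ∈ range n, (x i - y n)⁻¹ := by
    rw [Fin.prod_univ_castSucc, ← Fin.prod_univ_eq_prod_range (fun i => (x i - y n)⁻¹) n]
    simp only [rowG, if_true, (Fin.castSucc_lt_last _).ne, if_false, Fin.val_castSucc, mul_one]
  have hcolG : ∏ j, colG j = ∏ j ∈ range n, (y j - y n) := by
    rw [Fin.prod_univ_castSucc, ← Fin.prod_univ_eq_prod_range (fun j => y j - y n) n]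
    simp only [colG, if_true, (Fin.castSucc_lt_last _).ne, if_false, Fin.val_castSucc, mul_one]
  -- assemble
  rw [h1, h2det, h3, h4det, h5, hrowF, hcolF, hrowG, hcolG]
  rw [Finset.prod_mul_distrib, Finset.prod_mul_distrib, Finset.prod_inv_distrib, Finset.prod_inv_distrib]
  have hden1 : x n - y n ≠ 0 := sub_ne_zero.2 (hxy n n le_rfl le_rfl)
  have hden2 : ∏ i ∈ range n, (x n - y i) ≠ 0 :=
    Finset.prod_ne_zero_iff.2 fun i hi => sub_ne_zero.2 (hxy n i le_rfl (mem_range.1 hi).le)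
  have hden3 : ∏ i ∈ range n, (x i - y n) ≠ 0 :=
    Finset.prod_ne_zero_iff.2 fun i hi => sub_ne_zero.2 (hxy i n (mem_range.1 hi).le le_rfl)
  field_simp


/-- **Cauchy's double alternant in closed form** (Krattenthaler 1999, eq. (2.7), by induction from
`det_cauchyMatrix_succ`): if `x_i ≠ y_j` for all `i, j < n`, then
`det C_n = (∏_{j<n} ∏_{i<j} (x_j - x_i)(y_i - y_j)) / (∏_{i<n} ∏_{j<n} (x_i - y_j))`.
[cite: Krattenthaler1999, §2.1, eq. (2.7) (Cauchy's double alternant)] -/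
theorem det_cauchyMatrix (x y : ℕ → K) (n : ℕ) (hxy : ∀ i j : ℕ, i < n → j < n → x i ≠ y j) :
    (cauchyMatrix x y n).det =
      (∏ j ∈ range n, ∏ i ∈ range j, ((x j - x i) * (y i - y j))) /
        ∏ i ∈ range n, ∏ j ∈ range n, (x i - y j) := by
  induction n with
  | zero => simp
  | succ n ih =>
    have hxy' : ∀ i j : ℕ, i ≤ n → j ≤ n → x i ≠ y j := fun i j hi hj =>
      hxy i j (Nat.lt_succ_of_le hi) (Nat.lt_succ_of_le hj)
    have ih' := ih fun i j hi hj => hxy i j (Nat.lt_succ_of_lt hi) (Nat.lt_succ_of_lt hj)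
    rw [det_cauchyMatrix_succ x y n hxy', ih', Finset.prod_range_succ]
    -- split the (n+1) × (n+1) denominator product
    have hQ : ∏ i ∈ range (n + 1), ∏ j ∈ range (n + 1), (x i - y j)
        = (∏ i ∈ range n, ∏ j ∈ range n, (x i - y j)) *
            ((x n - y n) * ((∏ i ∈ range n, (x n - y i)) * ∏ i ∈ range n, (x i - y n))) := by
      rw [Finset.prod_range_succ]
      simp_rw [Finset.prod_range_succ]
      rw [Finset.prod_mul_distrib]
      ring
    rw [hQ]
    simp only [Finset.prod_mul_distrib]
    -- non-vanishing of the denominators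
    have hQn : ∏ i ∈ range n, ∏ j ∈ range n, (x i - y j) ≠ 0 :=
      Finset.prod_ne_zero_iff.2 fun i hi => Finset.prod_ne_zero_iff.2 fun j hj =>
        sub_ne_zero.2 (hxy i j (Nat.lt_succ_of_lt (mem_range.1 hi)) (Nat.lt_succ_of_lt (mem_range.1 hj)))
    have hd : x n - y n ≠ 0 := sub_ne_zero.2 (hxy n n n.lt_succ_self n.lt_succ_self)
    have hU1 : ∏ i ∈ range n, (x n - y i) ≠ 0 :=
      Finset.prod_ne_zero_iff.2 fun i hi => sub_ne_zero.2 (hxy n i n.lt_succ_self (Nat.lt_succ_of_lt (mem_range.1 hi)))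
    have hU2 : ∏ i ∈ range n, (x i - y n) ≠ 0 :=
      Finset.prod_ne_zero_iff.2 fun i hi => sub_ne_zero.2 (hxy i n (Nat.lt_succ_of_lt (mem_range.1 hi)) n.lt_succ_self)
    field_simp

end Literature.LinearAlgebra.Matrix
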